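import Summits.HubbardSuperconductivity.HubbardSuperconductivity.Theorems.KLProgrammeKLRegimeScaleZeroReadFirstOrder
import Summits.HubbardSuperconductivity.HubbardSuperconductivity.Theorems.KLProgrammeKLRegimeFlowPieceMeanDominates
import Summits.HubbardSuperconductivity.HubbardSuperconductivity.Theorems.KLProgrammeKLRegimeEngineV17F2ClosersCGQGuardDegenerate
import Summits.HubbardSuperconductivity.HubbardSuperconductivity.Theorems.KLProgrammeKLRegimeScaleZeroTwoLegTail3OnSite
import Summits.HubbardSuperconductivity.HubbardSuperconductivity.Theorems.KLProgrammeKLRegimeEngineScaleZeroThetaPackage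
import Summits.HubbardSuperconductivity.HubbardSuperconductivity.Theorems.KLProgrammeKLRegimeEngineV8DoorNumeralU9
import Literature.Analysis.FunctionSpaces.TorusLatticeWeightSumBound

/-!
# Route `KLProgramme`, crux K3 — ENGINE (stmt-HubbardSuperconductivity-20437), row (C) credit path: **GAP G-005 «(C)-TADPOLE-NONVANISHING» CLOSED
# ON THE ENGINE REGIME** — `∃ q, evalM (klFlowPiece L M β U μ 0) q ≠ 0` for `μ ∈ klWindowC`, `0 < U ≤ klEngU₀9 P R c`, `klBetaMin ≤ β`, `klEngL₃ ≤ L`, `klEngM₃ ≤ M`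

Seat hubbard-kl-k3c5-p1 (g19; writer of the G-005 owner lemma, pen (R435)(B)/(R436)(B); p1b g18 x-reads).  «G005-SHORT-ROAD», last file:
* §3 (consumer currency) **`exists_evalM_klFlowPiece_zero_ne_zero_of_rows`**: the owner lemma `|ν₀(θ) + U·T₀| ≤ E` (`…ScaleZeroReadFirstOrder`) gives
  mean `−U·T₀ ± E` (`abs_klAngularMean_le'`, `klAngularMean_add_const`) and oscillation `≤ 2E`; with the FIT `3E < U·T₀`, route (B) (✓ p718566
  `exists_evalM_klFlowPiece_zero_ne_zero_of_mean_dominates`) gives the flow piece a nonzero value.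
* §4 THE DISCHARGE on the engine regime, every row ANALYTIC: free-curve `C⁴` data (`freeFermiPointLp_C4`, part 2); tail rows from `…Tail3OnSite` BOOKED at the unweighted size `a = klScaleZeroA0` (`scaleZero_tailRows_klEng`:
  `tv = 2¹³e²⁷46³a²/10⁷⁴`, `tb₀ = 2¹³e²⁷46³a²/10³⁷`); plain sunset sum `bSA = 256·a` (`sunset_plainSum_le_of_col` ∘ `colSum_scaleZero_le_A0`);
  chain aliasing table `a j := (its own majorant)/U²` with the `j = 0` entry `≤ 10⁶⁰·U¹⁰` (`aliasZero_le`: `‖κ‖·8βL²·64 ≤ 2¹³U²`, `(2/N)⁴ ≤ (4/L)⁴ ≤ U⁸/2³²`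
  from `klEngL₃ ≥ 2¹⁰U⁻²`, `4C₂ ≤ 81`); the fit from `T₀ ≥ 1/128` (`scaleZero_tadpole_re_ge_inv_128`, part 2), `U ≤ klEngU₀9 ≤ 10⁻³⁷`,
  `a ≤ 2⁴³`, `e ≤ 3`: **`exists_evalM_klFlowPiece_zero_ne_zero_klEng`**, and the (C) closer's guarded conjunct **`hresGuard_gfr_row_klEng`**
  (`R.WF2`, history at the dummy frame, regime ⇒ `1 ≤ n → 0 < R.Gfr 0`) — the residual of record of `hres′` WITHOUT a tadpole hypothesis.
Proofs only; no definitions; nothing here asserts (C), any stub of 20437, K3 or superconductivity (G-005 = the first-order Hartree constant `≥ U/128` dominates at `U ≤ 10⁻³⁷`).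
References: BGM 2006 §2.1 (2.3)–(2.6), §2.3–§2.4, §3 (3.2)–(3.3) [cite: BenfattoGiulianiMastropietro2006].
-/

noncomputable section

namespace Summit.HubbardSuperconductivity.HubbardSuperconductivity.Theorems.KLRegimeSplit

set_option linter.dupNamespace false -- summit = problem name (single-conjunct summit), D-0017

open Real Finset Complex Literature.MathematicalPhysics.QuantumLattice Literature.Probability.LatticeModels GrassmannAlgebra Matrix
open Literature.MathematicalPhysics.QuantumLattice.FermiRG Literature.Probability.LatticeModels.BattleFederbush
open Summit.HubbardSuperconductivity.HubbardSuperconductivity.Theorems.KLProgrammeLegKernels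
open Summit.HubbardSuperconductivity.HubbardSuperconductivity.Theorems.TwoLegFourier
open Summit.HubbardSuperconductivity.HubbardSuperconductivity.Theorems.EngineV8
open Summit.HubbardSuperconductivity.HubbardSuperconductivity.Theorems.PerturbedFermiCurve
open Summit.HubbardSuperconductivity.HubbardSuperconductivity.Theorems.DispersionFlow
open Summit.HubbardSuperconductivity.HubbardSuperconductivity.Theorems.C4a (bell4)
open scoped Nat

/-! ## §3 G-005 in the currency of the consumer -/

section G005

variable {L M : ℕ} [NeZero L] [NeZero M] {μ U β : ℝ}

/-- **G-005 IN THE CURRENCY OF THE CONSUMER** (route (B), ✓ p718566): the mean of `ν₀` is `−U·T₀` up to `E` (`abs_klAngularMean_le'`,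
`klAngularMean_add_const`), the oscillation is `≤ 2E`; if the first-order constant dominates, `3E < U·T₀`, the scale-`0` flow piece does not
vanish identically: `∃ q, evalM (klFlowPiece L M β U μ 0) q ≠ 0`.  On the engine regime `T₀ ≥ 1/128` (`…ScaleZeroTadpoleRegime` ∘ `…TadpoleBridge`)
and `U ≤ klEngU₀4 ≤ 2⁻¹³²`, so `hfit` is the arithmetic `6tv + 3(2tb₀ + bSA + a₀ + 2048 + 64ε)·U < 1/128` of the ANALYTIC rows.
[cite: BenfattoGiulianiMastropietro2006, §3 (3.2)] -/
theorem exists_evalM_klFlowPiece_zero_ne_zero_of_rows (hβ : klBetaMin ≤ β) (hμ : μ ∈ klWindowC) {tv tb0 bSA : ℝ} {D a : ℕ → ℝ}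
    {Mdeg : ℕ} (hM : 8 ≤ Mdeg)
    (hTon : ∀ (σ : Fin 2) (p₀ : GridPoint L (2 * (2 * M))), ∑ p₁ : GridPoint L (2 * (2 * M)),
      (if p₁.2 - p₀.2 = 0 then (1 : ℝ) else 0) * ‖kernel ℂ (effAction ℂ ((hubbardGridSub L M β (2 * (2 * M))).transpose * hubbardCovAboveCT L M β μ 0 0 klE0 *
            hubbardGridSub L M β (2 * (2 * M))) (hubbardGridInteraction L (2 * (2 * M)) β U) -
          gaussConv ℂ ((hubbardGridSub L M β (2 * (2 * M))).transpose * hubbardCovAboveCT L M β μ 0 0 klE0 *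
            hubbardGridSub L M β (2 * (2 * M))) (hubbardGridInteraction L (2 * (2 * M)) β U) +
        (2 : ℂ)⁻¹ • (gaussConv ℂ ((hubbardGridSub L M β (2 * (2 * M))).transpose * hubbardCovAboveCT L M β μ 0 0 klE0 *
              hubbardGridSub L M β (2 * (2 * M))) (hubbardGridInteraction L (2 * (2 * M)) β U * hubbardGridInteraction L (2 * (2 * M)) β U) -
          gaussConv ℂ ((hubbardGridSub L M β (2 * (2 * M))).transpose * hubbardCovAboveCT L M β μ 0 0 klE0 *
              hubbardGridSub L M β (2 * (2 * M))) (hubbardGridInteraction L (2 * (2 * M)) β U) *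
            gaussConv ℂ ((hubbardGridSub L M β (2 * (2 * M))).transpose * hubbardCovAboveCT L M β μ 0 0 klE0 *
              hubbardGridSub L M β (2 * (2 * M))) (hubbardGridInteraction L (2 * (2 * M)) β U))) 2 (fun i => ((![p₀, p₁] i, σ), i))‖ ≤ tv * |U| * (β / ((2 * (2 * M) : ℕ) : ℝ)))
    (hToff0 : ∀ (σ : Fin 2) (p₀ : GridPoint L (2 * (2 * M))), ∑ p₁ : GridPoint L (2 * (2 * M)),
      (if p₁.2 - p₀.2 = 0 then (0 : ℝ) else
        (1 + (((p₁.2 - p₀.2) 0).valMinAbs.natAbs : ℝ) + (((p₁.2 - p₀.2) 1).valMinAbs.natAbs : ℝ)) ^ 0) *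
        ‖kernel ℂ (effAction ℂ ((hubbardGridSub L M β (2 * (2 * M))).transpose * hubbardCovAboveCT L M β μ 0 0 klE0 *
            hubbardGridSub L M β (2 * (2 * M))) (hubbardGridInteraction L (2 * (2 * M)) β U) -
          gaussConv ℂ ((hubbardGridSub L M β (2 * (2 * M))).transpose * hubbardCovAboveCT L M β μ 0 0 klE0 *
            hubbardGridSub L M β (2 * (2 * M))) (hubbardGridInteraction L (2 * (2 * M)) β U) +
        (2 : ℂ)⁻¹ • (gaussConv ℂ ((hubbardGridSub L M β (2 * (2 * M))).transpose * hubbardCovAboveCT L M β μ 0 0 klE0 *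
              hubbardGridSub L M β (2 * (2 * M))) (hubbardGridInteraction L (2 * (2 * M)) β U * hubbardGridInteraction L (2 * (2 * M)) β U) -
          gaussConv ℂ ((hubbardGridSub L M β (2 * (2 * M))).transpose * hubbardCovAboveCT L M β μ 0 0 klE0 *
              hubbardGridSub L M β (2 * (2 * M))) (hubbardGridInteraction L (2 * (2 * M)) β U) *
            gaussConv ℂ ((hubbardGridSub L M β (2 * (2 * M))).transpose * hubbardCovAboveCT L M β μ 0 0 klE0 *
              hubbardGridSub L M β (2 * (2 * M))) (hubbardGridInteraction L (2 * (2 * M)) β U))) 2 (fun i => ((![p₀, p₁] i, σ), i))‖ ≤ tb0 * U ^ 2 * (β / ((2 * (2 * M) : ℕ) : ℝ)))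
    (hSall : ∀ (σ : Fin 2) (p₀ : GridPoint L (2 * (2 * M))), ∑ p₁ : GridPoint L (2 * (2 * M)),
      (if p₁ = p₀ then (0 : ℝ) else (1 : ℝ) * ‖contr ℂ ((hubbardGridSub L M β (2 * (2 * M))).transpose * hubbardCovAboveCT L M β μ 0 0 klE0 *
                hubbardGridSub L M β (2 * (2 * M))) (((p₁, σ), 0) : GridLeg (GridPoint L (2 * (2 * M)))) ((p₀, σ), 1) *
              (contr ℂ ((hubbardGridSub L M β (2 * (2 * M))).transpose * hubbardCovAboveCT L M β μ 0 0 klE0 *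
                hubbardGridSub L M β (2 * (2 * M))) (((p₀, σ.rev), 0) : GridLeg (GridPoint L (2 * (2 * M)))) ((p₁, σ.rev), 1) *
                contr ℂ ((hubbardGridSub L M β (2 * (2 * M))).transpose * hubbardCovAboveCT L M β μ 0 0 klE0 *
                hubbardGridSub L M β (2 * (2 * M))) (((p₁, σ.rev), 0) : GridLeg (GridPoint L (2 * (2 * M)))) ((p₀, σ.rev), 1))‖) ≤ bSA * (((2 * (2 * M) : ℕ) : ℝ) / β))
    (hγ : ContDiff ℝ 4 fun θ : ℝ => (WithLp.toLp 2 (klFermiPoint μ 0 θ) : Momentum))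
    (hD : ∀ θ : ℝ, ∀ i, 1 ≤ i → i ≤ 4 → ‖iteratedDeriv i (fun θ : ℝ => (WithLp.toLp 2 (klFermiPoint μ 0 θ) : Momentum)) θ‖ ≤ D i)
    (hA : ∀ j ≤ 4, 2 * ((3 : ℝ) ^ j *
      (‖(-(((U * (β / (2 * (2 * M) : ℕ)) : ℝ) : ℂ) ^ 2 *
              ((-∑ k : FreqMomentum L M, ((1 / (β * (L : ℝ) ^ 2) : ℝ) : ℂ) ^ 2 * uvSymbolCT L M β μ 0 klE0 (k, 0)) *
               (-∑ k : FreqMomentum L M, ((1 / (β * (L : ℝ) ^ 2) : ℝ) : ℂ) ^ 2 * uvSymbolCT L M β μ 0 klE0 (k, 0)))) * ((((2 * (2 * M) : ℕ) : ℂ) ^ 2 / (β ^ 3 * (L : ℝ) ^ 2 : ℝ)) : ℂ))‖ *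
        (8 * (|β * (L : ℝ) ^ 2| * (2 / klE0)) * ((Mdeg ! : ℝ)) ^ 2 * (4 * 4 * (1 + 2 * (16 * (1 + 342) / klE0))) ^ Mdeg)) *
      (2 / ((2 * (L / 4 + 1) : ℕ) : ℝ)) ^ (Mdeg - j - 4) * (2 ^ 2 * ∑' k : Fin 2 → ℤ, ∏ i, (1 + (k i : ℝ) ^ 2)⁻¹)) ≤ a j * U ^ 2)
    (hfit : 3 * (2 * tv * |U| + (2 * tb0 + bSA + a 0 + 2048 + 64 * (β / ((2 * (2 * M) : ℕ) : ℝ))) * U ^ 2) <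
      U * (∑ k : FreqMomentum L M, ((1 / (β * (L : ℝ) ^ 2) : ℝ) : ℂ) ^ 2 * uvSymbolCT L M β μ 0 klE0 (k, 0)).re) :
    ∃ q : Momentum, evalM (klFlowPiece L M β U μ 0) q ≠ 0 := by
  have hE := fun θ => scaleZeroRead_add_firstOrder_le (L := L) (M := M) hβ hμ hM hTon hToff0 hSall hγ hD hA θ
  have hC := contDiff_four_klLocalPart_frameZero (L := L) (M := M) (μ := μ) (U := U) (β := β) hγ
  have hint : IntervalIntegrable (fun θ : ℝ => klLocalPart L M β U μ 0 0 θ) MeasureTheory.volume 0 (2 * π) :=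
    hC.continuous.intervalIntegrable _ _
  -- the mean is `−U·T₀` up to `E`
  have hmean : |klAngularMean (fun θ : ℝ => klLocalPart L M β U μ 0 0 θ) + U * (∑ k : FreqMomentum L M, ((1 / (β * (L : ℝ) ^ 2) : ℝ) : ℂ) ^ 2 * uvSymbolCT L M β μ 0 klE0 (k, 0)).re| ≤
      (2 * tv * |U| + (2 * tb0 + bSA + a 0 + 2048 + 64 * (β / ((2 * (2 * M) : ℕ) : ℝ))) * U ^ 2) := by
    have h := abs_klAngularMean_le' (f := fun θ : ℝ => klLocalPart L M β U μ 0 0 θ + U * (∑ k : FreqMomentum L M, ((1 / (β * (L : ℝ) ^ 2) : ℝ) : ℂ) ^ 2 * uvSymbolCT L M β μ 0 klE0 (k, 0)).re) hE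
    rwa [klAngularMean_add_const hint] at h
  -- the oscillation is `≤ 2E`
  have hosc : ∀ θ : ℝ, |klLocalPart L M β U μ 0 0 θ - klAngularMean (fun θ : ℝ => klLocalPart L M β U μ 0 0 θ)| ≤
      2 * (2 * tv * |U| + (2 * tb0 + bSA + a 0 + 2048 + 64 * (β / ((2 * (2 * M) : ℕ) : ℝ))) * U ^ 2) := by
    intro θ
    have h1 := hE θ
    have h2 := hmean
    rw [abs_le] at h1 h2 ⊢
    constructor <;> linarith [h1.1, h1.2, h2.1, h2.2]
  refine exists_evalM_klFlowPiece_zero_ne_zero_of_mean_dominates hμ hC hosc ?_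
  rw [abs_le] at hmean
  have hneg : klAngularMean (fun θ : ℝ => klLocalPart L M β U μ 0 0 θ) < 0 := by linarith [hmean.2]
  rw [abs_of_neg hneg]
  linarith [hmean.2]

end G005
/-! ## §4 The discharge on the engine regime -/

section Discharge

variable {L M : ℕ} [NeZero L] [NeZero M] {μ U β : ℝ}

/-- **The two TAIL rows of the owner lemma, BOOKED at the unweighted size `a = klScaleZeroA0`** on the engine regime (`R.WF2`, `U ≤ klEngU₀9 P R c`):
`tv = 2¹³e²⁷46³a²/10⁷⁴`, `tb₀ = (2/1)⁰·2¹³e²⁷46³a²/10³⁷` (`…Tail3OnSite`, weight `(1+s)⁰ = 1`). [cite: BenfattoGiulianiMastropietro2006, §2.4] -/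
theorem scaleZero_tailRows_klEng (P : SplitConsts) {R : RenConsts} (c : ℝ) (hR : R.WF2) (hμ : μ ∈ klWindowC) (hU : 0 < U)
    (hU9 : U ≤ klEngU₀9 P R c) (hβ : klBetaMin ≤ β) (hL : klEngL₃ β U ≤ L) (hM : klEngM₃ β U L ≤ M) :
    (∀ (σ : Fin 2) (p₀ : GridPoint L (2 * (2 * M))), ∑ p₁ : GridPoint L (2 * (2 * M)),
      (if p₁.2 - p₀.2 = 0 then (1 : ℝ) else 0) * ‖kernel ℂ (effAction ℂ ((hubbardGridSub L M β (2 * (2 * M))).transpose * hubbardCovAboveCT L M β μ 0 0 klE0 *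
            hubbardGridSub L M β (2 * (2 * M))) (hubbardGridInteraction L (2 * (2 * M)) β U) -
          gaussConv ℂ ((hubbardGridSub L M β (2 * (2 * M))).transpose * hubbardCovAboveCT L M β μ 0 0 klE0 *
            hubbardGridSub L M β (2 * (2 * M))) (hubbardGridInteraction L (2 * (2 * M)) β U) +
        (2 : ℂ)⁻¹ • (gaussConv ℂ ((hubbardGridSub L M β (2 * (2 * M))).transpose * hubbardCovAboveCT L M β μ 0 0 klE0 *
              hubbardGridSub L M β (2 * (2 * M))) (hubbardGridInteraction L (2 * (2 * M)) β U * hubbardGridInteraction L (2 * (2 * M)) β U) -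
          gaussConv ℂ ((hubbardGridSub L M β (2 * (2 * M))).transpose * hubbardCovAboveCT L M β μ 0 0 klE0 *
              hubbardGridSub L M β (2 * (2 * M))) (hubbardGridInteraction L (2 * (2 * M)) β U) *
            gaussConv ℂ ((hubbardGridSub L M β (2 * (2 * M))).transpose * hubbardCovAboveCT L M β μ 0 0 klE0 *
              hubbardGridSub L M β (2 * (2 * M))) (hubbardGridInteraction L (2 * (2 * M)) β U))) 2 (fun i => ((![p₀, p₁] i, σ), i))‖ ≤ ((2 : ℝ) ^ 13 * Real.exp 1 ^ 27 * (46 : ℝ) ^ 3 * klScaleZeroA0 ^ 2 / (10 : ℝ) ^ 74) * |U| * (β / ((2 * (2 * M) : ℕ) : ℝ))) ∧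
    (∀ (σ : Fin 2) (p₀ : GridPoint L (2 * (2 * M))), ∑ p₁ : GridPoint L (2 * (2 * M)),
      (if p₁.2 - p₀.2 = 0 then (0 : ℝ) else
        (1 + (((p₁.2 - p₀.2) 0).valMinAbs.natAbs : ℝ) + (((p₁.2 - p₀.2) 1).valMinAbs.natAbs : ℝ)) ^ 0) *
        ‖kernel ℂ (effAction ℂ ((hubbardGridSub L M β (2 * (2 * M))).transpose * hubbardCovAboveCT L M β μ 0 0 klE0 *
            hubbardGridSub L M β (2 * (2 * M))) (hubbardGridInteraction L (2 * (2 * M)) β U) -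
          gaussConv ℂ ((hubbardGridSub L M β (2 * (2 * M))).transpose * hubbardCovAboveCT L M β μ 0 0 klE0 *
            hubbardGridSub L M β (2 * (2 * M))) (hubbardGridInteraction L (2 * (2 * M)) β U) +
        (2 : ℂ)⁻¹ • (gaussConv ℂ ((hubbardGridSub L M β (2 * (2 * M))).transpose * hubbardCovAboveCT L M β μ 0 0 klE0 *
              hubbardGridSub L M β (2 * (2 * M))) (hubbardGridInteraction L (2 * (2 * M)) β U * hubbardGridInteraction L (2 * (2 * M)) β U) -
          gaussConv ℂ ((hubbardGridSub L M β (2 * (2 * M))).transpose * hubbardCovAboveCT L M β μ 0 0 klE0 *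
              hubbardGridSub L M β (2 * (2 * M))) (hubbardGridInteraction L (2 * (2 * M)) β U) *
            gaussConv ℂ ((hubbardGridSub L M β (2 * (2 * M))).transpose * hubbardCovAboveCT L M β μ 0 0 klE0 *
              hubbardGridSub L M β (2 * (2 * M))) (hubbardGridInteraction L (2 * (2 * M)) β U))) 2 (fun i => ((![p₀, p₁] i, σ), i))‖ ≤ ((2 / (1 : ℝ)) ^ 0 * ((2 : ℝ) ^ 13 * Real.exp 1 ^ 27 * (46 : ℝ) ^ 3 * klScaleZeroA0 ^ 2) / (10 : ℝ) ^ 37) * U ^ 2 * (β / ((2 * (2 * M) : ℕ) : ℝ))) := by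
  obtain ⟨-, -, -, -, hβ3M, -⟩ := scaleZero_regime_sizes (U := U) hβ hL hM
  have hK0 : FrameOK R U 0 μ 0 := klFrameOK_zeroC hR.1 U 0 hμ
  have hrow : ∀ X, ∑ Y, ‖((hubbardGridSub L M β (2 * (2 * M))).transpose * hubbardCovAboveCT L M β μ 0 0 klE0 *
        hubbardGridSub L M β (2 * (2 * M))) X Y‖ ≤ klScaleZeroA0 * ((2 * (2 * M) : ℕ) : ℝ) / β := fun X =>
    (rowSum_scaleZero_le_A0 (L := L) hK0 hβ hβ3M X).trans (le_of_eq (by ring))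
  have hcol : ∀ Y, ∑ X, ‖((hubbardGridSub L M β (2 * (2 * M))).transpose * hubbardCovAboveCT L M β μ 0 0 klE0 *
        hubbardGridSub L M β (2 * (2 * M))) X Y‖ ≤ klScaleZeroA0 * ((2 * (2 * M) : ℕ) : ℝ) / β := fun Y =>
    (colSum_scaleZero_le_A0 (L := L) hK0 hβ hβ3M Y).trans (le_of_eq (by ring))
  have hwt : ∀ S : Finset (ZMod (2 * (2 * M)) × TorusSite 2 L),
      diamWeight (fun s => (1 + 1 * s) ^ 0) (gridLabelDist L (2 * (2 * M)) β) S = 1 := fun S => by simp [diamWeight]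
  have hrowW : ∀ X, ∑ Y, ‖((hubbardGridSub L M β (2 * (2 * M))).transpose * hubbardCovAboveCT L M β μ 0 0 klE0 *
        hubbardGridSub L M β (2 * (2 * M))) X Y‖ * diamWeight (fun s => (1 + 1 * s) ^ 0) (gridLabelDist L (2 * (2 * M)) β) {gridLegPos X, gridLegPos Y} ≤
      klScaleZeroA0 * ((2 * (2 * M) : ℕ) : ℝ) / β := fun X => by simp_rw [hwt, mul_one]; exact hrow X
  have hcolW : ∀ Y, ∑ X, ‖((hubbardGridSub L M β (2 * (2 * M))).transpose * hubbardCovAboveCT L M β μ 0 0 klE0 *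
        hubbardGridSub L M β (2 * (2 * M))) X Y‖ * diamWeight (fun s => (1 + 1 * s) ^ 0) (gridLabelDist L (2 * (2 * M)) β) {gridLegPos X, gridLegPos Y} ≤
      klScaleZeroA0 * ((2 * (2 * M) : ℕ) : ℝ) / β := fun Y => by simp_rw [hwt, mul_one]; exact hcol Y
  have hsmall : 16 * Real.exp 1 ^ 9 * 46 * klScaleZeroA0 * |U| ≤ 1 / 2 := by
    have h := (bareFrame_numerals_of_le_klEngU₀9 P hR.2.2 hU hU9).1
    have hsq : Real.sqrt (2 * (7 + 1606732)) ^ 2 = 2 * (7 + 1606732) := Real.sq_sqrt (by norm_num)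
    rw [hsq] at h
    have h0 : 0 ≤ 16 * Real.exp 1 ^ 9 * klScaleZeroA0 * |U| :=
      mul_nonneg (mul_nonneg (by positivity) klScaleZeroA0_pos.le) (abs_nonneg U)
    have h1 : 16 * Real.exp 1 ^ 9 * 46 * klScaleZeroA0 * |U| = (16 * Real.exp 1 ^ 9 * klScaleZeroA0 * |U|) * 46 := by ring
    have h2 : 16 * Real.exp 1 ^ 9 * (2 * (7 + 1606732)) * klScaleZeroA0 * |U| =
        (16 * Real.exp 1 ^ 9 * klScaleZeroA0 * |U|) * (2 * (7 + 1606732)) := by ring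
    rw [h2] at h
    rw [h1]
    nlinarith
  refine ⟨fun σ p₀ => ?_, fun σ p₀ => ?_⟩
  · exact twoLeg_wsum_tail3_frameZero_le_booked (L := L) (M := M) hμ hU hU9 hβ hL klScaleZeroA0_pos hrow hcol hsmall
      (fun p₀ p₁ : GridPoint L (2 * (2 * M)) => if p₁.2 - p₀.2 = 0 then (1 : ℝ) else 0)
      (fun p q => by split_ifs <;> norm_num) (fun p q => by split_ifs <;> norm_num) σ p₀
  · exact twoLeg_offDiag_moment_pow_sum_tail3_frameZero_le_booked (L := L) (M := M) hμ hU hU9 hβ hL 0 one_pos le_rfl klScaleZeroA0_pos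
      hrowW hcolW hsmall σ p₀

/-- **The `j = 0` entry of the chain's aliasing majorant is `≤ 10⁶⁰·U¹⁰` on the regime** (`Mdeg = 8`): `‖κ‖·8|βL²|·(2/klE0) ≤ 2¹³U²` (`|t| ≤ 4`),
`(8!)² = 1625702400`, `(16·351233)⁸`, `(2/N)⁴ ≤ (4/L)⁴ ≤ U⁸/2³²` (`L ≥ klEngL₃ ≥ 2¹⁰U⁻²`), `2²C₂ ≤ 81`. [cite: BenfattoGiulianiMastropietro2006, §2.4] -/
theorem aliasZero_le {β : ℝ} (hβ : klBetaMin ≤ β) (hU : 0 < U) (hL : klEngL₃ β U ≤ L) (μ : ℝ) :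
    2 * ((3 : ℝ) ^ 0 *
      (‖(-(((U * (β / (2 * (2 * M) : ℕ)) : ℝ) : ℂ) ^ 2 *
              ((-∑ k : FreqMomentum L M, ((1 / (β * (L : ℝ) ^ 2) : ℝ) : ℂ) ^ 2 * uvSymbolCT L M β μ 0 klE0 (k, 0)) *
               (-∑ k : FreqMomentum L M, ((1 / (β * (L : ℝ) ^ 2) : ℝ) : ℂ) ^ 2 * uvSymbolCT L M β μ 0 klE0 (k, 0)))) * ((((2 * (2 * M) : ℕ) : ℂ) ^ 2 / (β ^ 3 * (L : ℝ) ^ 2 : ℝ)) : ℂ))‖ *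
        (8 * (|β * (L : ℝ) ^ 2| * (2 / klE0)) * ((8 ! : ℝ)) ^ 2 * (4 * 4 * (1 + 2 * (16 * (1 + 342) / klE0))) ^ 8)) *
      (2 / ((2 * (L / 4 + 1) : ℕ) : ℝ)) ^ (8 - 0 - 4) * (2 ^ 2 * ∑' k : Fin 2 → ℤ, ∏ i, (1 + (k i : ℝ) ^ 2)⁻¹)) ≤ (10 : ℝ) ^ 60 * U ^ 10 := by
  have hβ0 : 0 < β := lt_of_lt_of_le (by norm_num [klBetaMin]) hβ
  have hLnat : 1 ≤ L := Nat.pos_of_ne_zero (NeZero.ne L)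
  have hLpos : (0 : ℝ) < L := by exact_mod_cast hLnat
  have hN : (0 : ℝ) < ((2 * (2 * M) : ℕ) : ℝ) := by have := NeZero.ne M; positivity
  -- `L ≥ 2¹⁰/U²`
  have hLU : (2 : ℝ) ^ 10 / U ^ 2 ≤ (L : ℝ) := by
    unfold klEngL₃ at hL
    have hcast : ((2 ^ 10 * (⌈|β|⌉₊ + 1) ^ 2 * (⌈|U|⁻¹⌉₊ + 1) ^ 2 : ℕ) : ℝ) ≤ (L : ℝ) := by exact_mod_cast hL
    push_cast at hcast
    rw [abs_of_pos hU] at hcast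
    have hu : U⁻¹ ≤ (⌈U⁻¹⌉₊ : ℝ) + 1 := by
      have h1 : U⁻¹ ≤ (⌈U⁻¹⌉₊ : ℝ) := Nat.le_ceil _
      linarith
    have hu2 : U⁻¹ ^ 2 ≤ ((⌈U⁻¹⌉₊ : ℝ) + 1) ^ 2 := pow_le_pow_left₀ (by positivity) hu 2
    have hb : (1 : ℝ) ≤ ((⌈|β|⌉₊ : ℝ) + 1) ^ 2 := by
      have : (0 : ℝ) ≤ (⌈|β|⌉₊ : ℝ) := Nat.cast_nonneg _
      nlinarith
    have heq : (2 : ℝ) ^ 10 / U ^ 2 = 2 ^ 10 * 1 * U⁻¹ ^ 2 := by rw [inv_pow]; field_simp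
    rw [heq]
    have h0 : (0 : ℝ) ≤ U⁻¹ ^ 2 := by positivity
    calc (2 : ℝ) ^ 10 * 1 * U⁻¹ ^ 2 ≤ (2 : ℝ) ^ 10 * ((⌈|β|⌉₊ : ℝ) + 1) ^ 2 * ((⌈U⁻¹⌉₊ : ℝ) + 1) ^ 2 :=
          mul_le_mul (mul_le_mul_of_nonneg_left hb (by norm_num)) hu2 h0 (by positivity)
      _ ≤ (L : ℝ) := by have h' := hcast; norm_num at h' ⊢; exact h'
  -- `2/N ≤ 4/L ≤ U²/2⁸`
  have hN' : (L : ℝ) / 2 ≤ ((2 * (L / 4 + 1) : ℕ) : ℝ) := by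
    have h : L ≤ 2 * (2 * (L / 4 + 1)) := by omega
    have h' : (L : ℝ) ≤ 2 * ((2 * (L / 4 + 1) : ℕ) : ℝ) := by exact_mod_cast h
    linarith
  have hN'pos : (0 : ℝ) < ((2 * (L / 4 + 1) : ℕ) : ℝ) := by positivity
  have hrN : 2 / ((2 * (L / 4 + 1) : ℕ) : ℝ) ≤ U ^ 2 / 2 ^ 8 := by
    rw [div_le_iff₀ hN'pos]
    have h1 : U ^ 2 * (L : ℝ) ≥ 2 ^ 10 := by
      have := (div_le_iff₀ (by positivity : (0:ℝ) < U ^ 2)).1 hLU; linarith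
    nlinarith
  have hrN0 : 0 ≤ 2 / ((2 * (L / 4 + 1) : ℕ) : ℝ) := by positivity
  have hr4 : (2 / ((2 * (L / 4 + 1) : ℕ) : ℝ)) ^ (8 - 0 - 4) ≤ (U ^ 2 / 2 ^ 8) ^ 4 := by
    rw [show (8 - 0 - 4 : ℕ) = 4 from rfl]; exact pow_le_pow_left₀ hrN0 hrN 4
  -- `‖κ‖·8|βL²|(2/klE0) ≤ 2¹³·U²`
  have hT : ‖(-∑ k : FreqMomentum L M, ((1 / (β * (L : ℝ) ^ 2) : ℝ) : ℂ) ^ 2 * uvSymbolCT L M β μ 0 klE0 (k, 0))‖ ≤ 4 := by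
    rw [norm_neg]; exact norm_scaleZero_tadpole_le_four hβ0 μ 0
  have hκ : ‖(-(((U * (β / (2 * (2 * M) : ℕ)) : ℝ) : ℂ) ^ 2 *
              ((-∑ k : FreqMomentum L M, ((1 / (β * (L : ℝ) ^ 2) : ℝ) : ℂ) ^ 2 * uvSymbolCT L M β μ 0 klE0 (k, 0)) *
               (-∑ k : FreqMomentum L M, ((1 / (β * (L : ℝ) ^ 2) : ℝ) : ℂ) ^ 2 * uvSymbolCT L M β μ 0 klE0 (k, 0)))) * ((((2 * (2 * M) : ℕ) : ℂ) ^ 2 / (β ^ 3 * (L : ℝ) ^ 2 : ℝ)) : ℂ))‖ *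
      (8 * (|β * (L : ℝ) ^ 2| * (2 / klE0))) ≤ 2 ^ 13 * U ^ 2 := by
    have hUE : ‖((U * (β / (2 * (2 * M) : ℕ)) : ℝ) : ℂ)‖ = U * (β / ((2 * (2 * M) : ℕ) : ℝ)) := by
      rw [Complex.norm_real, Real.norm_eq_abs, abs_of_pos (by positivity)]
    have hX : ‖((((2 * (2 * M) : ℕ) : ℂ) ^ 2 / (β ^ 3 * (L : ℝ) ^ 2 : ℝ)) : ℂ)‖ = ((2 * (2 * M) : ℕ) : ℝ) ^ 2 / (β ^ 3 * (L : ℝ) ^ 2) := by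
      rw [norm_div, norm_pow, Complex.norm_natCast, Complex.norm_real, Real.norm_eq_abs, abs_of_pos (by positivity)]
    rw [norm_mul, norm_neg, norm_mul, norm_pow, hUE, norm_mul, hX, abs_of_pos (by positivity : (0:ℝ) < β * (L : ℝ) ^ 2),
      show klE0 = 1 / 32 from rfl]
    have hT2 : ‖(-∑ k : FreqMomentum L M, ((1 / (β * (L : ℝ) ^ 2) : ℝ) : ℂ) ^ 2 * uvSymbolCT L M β μ 0 klE0 (k, 0))‖ *
        ‖(-∑ k : FreqMomentum L M, ((1 / (β * (L : ℝ) ^ 2) : ℝ) : ℂ) ^ 2 * uvSymbolCT L M β μ 0 klE0 (k, 0))‖ ≤ 16 := by nlinarith [norm_nonneg (-∑ k : FreqMomentum L M, ((1 / (β * (L : ℝ) ^ 2) : ℝ) : ℂ) ^ 2 * uvSymbolCT L M β μ 0 klE0 (k, 0))]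
    have hkey : (U * (β / ((2 * (2 * M) : ℕ) : ℝ))) ^ 2 * (((2 * (2 * M) : ℕ) : ℝ) ^ 2 / (β ^ 3 * (L : ℝ) ^ 2)) *
        (8 * (β * (L : ℝ) ^ 2 * (2 / (1 / 32)))) = 2 ^ 9 * U ^ 2 := by
      field_simp; ring
    calc (U * (β / ((2 * (2 * M) : ℕ) : ℝ))) ^ 2 * (‖(-∑ k : FreqMomentum L M, ((1 / (β * (L : ℝ) ^ 2) : ℝ) : ℂ) ^ 2 * uvSymbolCT L M β μ 0 klE0 (k, 0))‖ *
          ‖(-∑ k : FreqMomentum L M, ((1 / (β * (L : ℝ) ^ 2) : ℝ) : ℂ) ^ 2 * uvSymbolCT L M β μ 0 klE0 (k, 0))‖) * (((2 * (2 * M) : ℕ) : ℝ) ^ 2 / (β ^ 3 * (L : ℝ) ^ 2)) * (8 * (β * (L : ℝ) ^ 2 * (2 / (1 / 32))))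
        = (‖(-∑ k : FreqMomentum L M, ((1 / (β * (L : ℝ) ^ 2) : ℝ) : ℂ) ^ 2 * uvSymbolCT L M β μ 0 klE0 (k, 0))‖ *
          ‖(-∑ k : FreqMomentum L M, ((1 / (β * (L : ℝ) ^ 2) : ℝ) : ℂ) ^ 2 * uvSymbolCT L M β μ 0 klE0 (k, 0))‖) * ((U * (β / ((2 * (2 * M) : ℕ) : ℝ))) ^ 2 * (((2 * (2 * M) : ℕ) : ℝ) ^ 2 / (β ^ 3 * (L : ℝ) ^ 2)) *
            (8 * (β * (L : ℝ) ^ 2 * (2 / (1 / 32))))) := by ring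
      _ ≤ 16 * (2 ^ 9 * U ^ 2) := by rw [hkey]; exact mul_le_mul_of_nonneg_right hT2 (by positivity)
      _ = 2 ^ 13 * U ^ 2 := by ring
  have hC₂ := Literature.Analysis.FunctionSpaces.Torus.tsum_prod_inv_one_add_sq_fin_two_le
  have hC₂0 : 0 ≤ ∑' k : Fin 2 → ℤ, ∏ i, (1 + (k i : ℝ) ^ 2)⁻¹ := tsum_nonneg fun k => prod_nonneg fun i _ => by positivity
  have hfac : ((8 ! : ℝ)) ^ 2 = 1625702400 := by norm_num [Nat.factorial]
  have hcst : (4 * 4 * (1 + 2 * (16 * (1 + 342) / klE0)) : ℝ) ^ 8 ≤ (10 : ℝ) ^ 54 := by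
    rw [show klE0 = 1 / 32 from rfl]; norm_num
  have hκ0 : 0 ≤ ‖(-(((U * (β / (2 * (2 * M) : ℕ)) : ℝ) : ℂ) ^ 2 *
              ((-∑ k : FreqMomentum L M, ((1 / (β * (L : ℝ) ^ 2) : ℝ) : ℂ) ^ 2 * uvSymbolCT L M β μ 0 klE0 (k, 0)) *
               (-∑ k : FreqMomentum L M, ((1 / (β * (L : ℝ) ^ 2) : ℝ) : ℂ) ^ 2 * uvSymbolCT L M β μ 0 klE0 (k, 0)))) * ((((2 * (2 * M) : ℕ) : ℂ) ^ 2 / (β ^ 3 * (L : ℝ) ^ 2 : ℝ)) : ℂ))‖ *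
      (8 * (|β * (L : ℝ) ^ 2| * (2 / klE0))) := mul_nonneg (norm_nonneg _) (by rw [show klE0 = 1 / 32 from rfl]; positivity)
  -- assemble
  have hU2 : 0 ≤ U ^ 2 := sq_nonneg U
  calc 2 * ((3 : ℝ) ^ 0 *
      (‖(-(((U * (β / (2 * (2 * M) : ℕ)) : ℝ) : ℂ) ^ 2 *
              ((-∑ k : FreqMomentum L M, ((1 / (β * (L : ℝ) ^ 2) : ℝ) : ℂ) ^ 2 * uvSymbolCT L M β μ 0 klE0 (k, 0)) *
               (-∑ k : FreqMomentum L M, ((1 / (β * (L : ℝ) ^ 2) : ℝ) : ℂ) ^ 2 * uvSymbolCT L M β μ 0 klE0 (k, 0)))) * ((((2 * (2 * M) : ℕ) : ℂ) ^ 2 / (β ^ 3 * (L : ℝ) ^ 2 : ℝ)) : ℂ))‖ *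
        (8 * (|β * (L : ℝ) ^ 2| * (2 / klE0)) * ((8 ! : ℝ)) ^ 2 * (4 * 4 * (1 + 2 * (16 * (1 + 342) / klE0))) ^ 8)) *
      (2 / ((2 * (L / 4 + 1) : ℕ) : ℝ)) ^ (8 - 0 - 4) * (2 ^ 2 * ∑' k : Fin 2 → ℤ, ∏ i, (1 + (k i : ℝ) ^ 2)⁻¹))
      = 2 * ((‖(-(((U * (β / (2 * (2 * M) : ℕ)) : ℝ) : ℂ) ^ 2 *
              ((-∑ k : FreqMomentum L M, ((1 / (β * (L : ℝ) ^ 2) : ℝ) : ℂ) ^ 2 * uvSymbolCT L M β μ 0 klE0 (k, 0)) *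
               (-∑ k : FreqMomentum L M, ((1 / (β * (L : ℝ) ^ 2) : ℝ) : ℂ) ^ 2 * uvSymbolCT L M β μ 0 klE0 (k, 0)))) * ((((2 * (2 * M) : ℕ) : ℂ) ^ 2 / (β ^ 3 * (L : ℝ) ^ 2 : ℝ)) : ℂ))‖ *
          (8 * (|β * (L : ℝ) ^ 2| * (2 / klE0)))) * (((8 ! : ℝ)) ^ 2 * (4 * 4 * (1 + 2 * (16 * (1 + 342) / klE0))) ^ 8)) *
        (2 / ((2 * (L / 4 + 1) : ℕ) : ℝ)) ^ (8 - 0 - 4) * (2 ^ 2 * ∑' k : Fin 2 → ℤ, ∏ i, (1 + (k i : ℝ) ^ 2)⁻¹) := by ring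
    _ ≤ 2 * ((2 ^ 13 * U ^ 2) * (1625702400 * (10 : ℝ) ^ 54)) * (U ^ 2 / 2 ^ 8) ^ 4 * (2 ^ 2 * (81 / 4)) := by
        rw [← hfac]
        gcongr
    _ ≤ (10 : ℝ) ^ 60 * U ^ 10 := by nlinarith [pow_nonneg hU2 5]

set_option maxHeartbeats 400000 in -- one instantiation of the consumer-currency theorem with written-out rows
/-- **G-005 ON THE ENGINE REGIME**: for `R.WF2`, `μ ∈ klWindowC`, `0 < U ≤ klEngU₀9 P R c`, `klBetaMin ≤ β`, `klEngL₃ β U ≤ L`, `klEngM₃ β U L ≤ M`, the scale-`0`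
flow piece of the dummy frame does not vanish identically: `∃ q, evalM (klFlowPiece L M β U μ 0) q ≠ 0`. [cite: BenfattoGiulianiMastropietro2006, §3 (3.2)] -/
theorem exists_evalM_klFlowPiece_zero_ne_zero_klEng (P : SplitConsts) {R : RenConsts} (c : ℝ) (hR : R.WF2) (hμ : μ ∈ klWindowC) (hU : 0 < U)
    (hU9 : U ≤ klEngU₀9 P R c) (hβ : klBetaMin ≤ β) (hL : klEngL₃ β U ≤ L) (hM : klEngM₃ β U L ≤ M) :
    ∃ q : Momentum, evalM (klFlowPiece L M β U μ 0) q ≠ 0 := by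
  obtain ⟨-, -, hM2, hβM, hβ3M, -⟩ := scaleZero_regime_sizes (U := U) hβ hL hM
  have hβ0 : 0 < β := lt_of_lt_of_le (by norm_num [klBetaMin]) hβ
  have hN : (0 : ℝ) < ((2 * (2 * M) : ℕ) : ℝ) := by have := NeZero.ne M; positivity
  obtain ⟨D, hγ, hD⟩ := freeFermiPointLp_C4 (μ := μ) hμ
  obtain ⟨hTon, hToff0⟩ := scaleZero_tailRows_klEng (L := L) (M := M) (β := β) P c hR hμ hU hU9 hβ hL hM
  have hK0 : FrameOK R U 0 μ 0 := klFrameOK_zeroC hR.1 U 0 hμ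
  have hcol : ∀ Y, ∑ X, ‖((hubbardGridSub L M β (2 * (2 * M))).transpose * hubbardCovAboveCT L M β μ 0 0 klE0 *
        hubbardGridSub L M β (2 * (2 * M))) X Y‖ ≤ klScaleZeroA0 * ((2 * (2 * M) : ℕ) : ℝ) / β := fun Y =>
    (colSum_scaleZero_le_A0 (L := L) hK0 hβ hβ3M Y).trans (le_of_eq (by ring))
  have hSall : ∀ (σ : Fin 2) (p₀ : GridPoint L (2 * (2 * M))), ∑ p₁ : GridPoint L (2 * (2 * M)),
      (if p₁ = p₀ then (0 : ℝ) else (1 : ℝ) * ‖contr ℂ ((hubbardGridSub L M β (2 * (2 * M))).transpose * hubbardCovAboveCT L M β μ 0 0 klE0 *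
                hubbardGridSub L M β (2 * (2 * M))) (((p₁, σ), 0) : GridLeg (GridPoint L (2 * (2 * M)))) ((p₀, σ), 1) *
              (contr ℂ ((hubbardGridSub L M β (2 * (2 * M))).transpose * hubbardCovAboveCT L M β μ 0 0 klE0 *
                hubbardGridSub L M β (2 * (2 * M))) (((p₀, σ.rev), 0) : GridLeg (GridPoint L (2 * (2 * M)))) ((p₁, σ.rev), 1) *
                contr ℂ ((hubbardGridSub L M β (2 * (2 * M))).transpose * hubbardCovAboveCT L M β μ 0 0 klE0 *
                hubbardGridSub L M β (2 * (2 * M))) (((p₁, σ.rev), 0) : GridLeg (GridPoint L (2 * (2 * M)))) ((p₀, σ.rev), 1))‖) ≤ 16 * 16 * klScaleZeroA0 * (((2 * (2 * M) : ℕ) : ℝ) / β) := fun σ p₀ =>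
    sunset_plainSum_le_of_col (L := L) (M := M) (U := U) hμ hβ hL hcol σ p₀
  refine exists_evalM_klFlowPiece_zero_ne_zero_of_rows (L := L) (M := M) (Mdeg := 8) hβ hμ (by norm_num) hTon hToff0 hSall hγ hD
    (a := fun j => (2 * ((3 : ℝ) ^ j *
      (‖(-(((U * (β / (2 * (2 * M) : ℕ)) : ℝ) : ℂ) ^ 2 *
              ((-∑ k : FreqMomentum L M, ((1 / (β * (L : ℝ) ^ 2) : ℝ) : ℂ) ^ 2 * uvSymbolCT L M β μ 0 klE0 (k, 0)) *
               (-∑ k : FreqMomentum L M, ((1 / (β * (L : ℝ) ^ 2) : ℝ) : ℂ) ^ 2 * uvSymbolCT L M β μ 0 klE0 (k, 0)))) * ((((2 * (2 * M) : ℕ) : ℂ) ^ 2 / (β ^ 3 * (L : ℝ) ^ 2 : ℝ)) : ℂ))‖ *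
        (8 * (|β * (L : ℝ) ^ 2| * (2 / klE0)) * ((8 ! : ℝ)) ^ 2 * (4 * 4 * (1 + 2 * (16 * (1 + 342) / klE0))) ^ 8)) *
      (2 / ((2 * (L / 4 + 1) : ℕ) : ℝ)) ^ (8 - j - 4) * (2 ^ 2 * ∑' k : Fin 2 → ℤ, ∏ i, (1 + (k i : ℝ) ^ 2)⁻¹))) / U ^ 2)
    (fun j _ => le_of_eq (div_mul_cancel₀ _ (pow_ne_zero 2 hU.ne')).symm) ?_
  -- the fit: every higher-order constant is negligible at `U ≤ 10⁻³⁷` against `T₀ ≥ 1/128`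
  have hT0 := scaleZero_tadpole_re_ge_inv_128 (L := L) (M := M) (U := U) hβ hμ hL hM
  have hU37 : U ≤ 1 / (10 : ℝ) ^ 37 := hU9.trans (klEngU₀9_le_inv_ten_pow_37 P R c)
  have hU1 : U ≤ 1 := hU37.trans (by norm_num)
  have hA0 := klScaleZeroA0_le_two_pow
  have hA00 := klScaleZeroA0_pos.le
  have he3 : Real.exp 1 ≤ 3 := by have := Real.exp_one_lt_d9; norm_num at this; linarith
  have he0 : 0 ≤ Real.exp 1 := (Real.exp_pos 1).le
  have hε1 : β / ((2 * (2 * M) : ℕ) : ℝ) ≤ 1 := by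
    rw [div_le_one hN]
    have hM' : (M : ℝ) ≤ ((2 * (2 * M) : ℕ) : ℝ) := by push_cast; linarith [show (0:ℝ) ≤ M from Nat.cast_nonneg M]
    linarith
  have hε0 : 0 ≤ β / ((2 * (2 * M) : ℕ) : ℝ) := by positivity
  -- the booked numerator
  have hS : (2 : ℝ) ^ 13 * Real.exp 1 ^ 27 * (46 : ℝ) ^ 3 * klScaleZeroA0 ^ 2 ≤ (10 : ℝ) ^ 48 := by
    have h1 : Real.exp 1 ^ 27 ≤ (3 : ℝ) ^ 27 := pow_le_pow_left₀ he0 he3 27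
    have h2 : klScaleZeroA0 ^ 2 ≤ ((2 : ℝ) ^ 43) ^ 2 := pow_le_pow_left₀ hA00 hA0 2
    calc (2 : ℝ) ^ 13 * Real.exp 1 ^ 27 * (46 : ℝ) ^ 3 * klScaleZeroA0 ^ 2 ≤ 2 ^ 13 * (3 : ℝ) ^ 27 * 46 ^ 3 * ((2 : ℝ) ^ 43) ^ 2 := by gcongr
      _ ≤ _ := by norm_num
  have hS0 : 0 ≤ (2 : ℝ) ^ 13 * Real.exp 1 ^ 27 * (46 : ℝ) ^ 3 * klScaleZeroA0 ^ 2 := by positivity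
  set S : ℝ := (2 : ℝ) ^ 13 * Real.exp 1 ^ 27 * (46 : ℝ) ^ 3 * klScaleZeroA0 ^ 2 with hSdef
  set X : ℝ := (2 * ((3 : ℝ) ^ 0 *
      (‖(-(((U * (β / (2 * (2 * M) : ℕ)) : ℝ) : ℂ) ^ 2 *
              ((-∑ k : FreqMomentum L M, ((1 / (β * (L : ℝ) ^ 2) : ℝ) : ℂ) ^ 2 * uvSymbolCT L M β μ 0 klE0 (k, 0)) *
               (-∑ k : FreqMomentum L M, ((1 / (β * (L : ℝ) ^ 2) : ℝ) : ℂ) ^ 2 * uvSymbolCT L M β μ 0 klE0 (k, 0)))) * ((((2 * (2 * M) : ℕ) : ℂ) ^ 2 / (β ^ 3 * (L : ℝ) ^ 2 : ℝ)) : ℂ))‖ *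
        (8 * (|β * (L : ℝ) ^ 2| * (2 / klE0)) * ((8 ! : ℝ)) ^ 2 * (4 * 4 * (1 + 2 * (16 * (1 + 342) / klE0))) ^ 8)) *
      (2 / ((2 * (L / 4 + 1) : ℕ) : ℝ)) ^ (8 - 0 - 4) * (2 ^ 2 * ∑' k : Fin 2 → ℤ, ∏ i, (1 + (k i : ℝ) ^ 2)⁻¹))) / U ^ 2 with hXdef
  set ε : ℝ := β / ((2 * (2 * M) : ℕ) : ℝ) with hεdef
  set T : ℝ := (∑ k : FreqMomentum L M, ((1 / (β * (L : ℝ) ^ 2) : ℝ) : ℂ) ^ 2 * uvSymbolCT L M β μ 0 klE0 (k, 0)).re with hTdef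
  have halias := aliasZero_le (L := L) (M := M) (U := U) hβ hU hL μ
  have hXU : X * U ^ 2 ≤ U ^ 2 := by
    have hX1 : X * U ^ 2 = 2 * ((3 : ℝ) ^ 0 *
      (‖(-(((U * (β / (2 * (2 * M) : ℕ)) : ℝ) : ℂ) ^ 2 *
              ((-∑ k : FreqMomentum L M, ((1 / (β * (L : ℝ) ^ 2) : ℝ) : ℂ) ^ 2 * uvSymbolCT L M β μ 0 klE0 (k, 0)) *
               (-∑ k : FreqMomentum L M, ((1 / (β * (L : ℝ) ^ 2) : ℝ) : ℂ) ^ 2 * uvSymbolCT L M β μ 0 klE0 (k, 0)))) * ((((2 * (2 * M) : ℕ) : ℂ) ^ 2 / (β ^ 3 * (L : ℝ) ^ 2 : ℝ)) : ℂ))‖ *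
        (8 * (|β * (L : ℝ) ^ 2| * (2 / klE0)) * ((8 ! : ℝ)) ^ 2 * (4 * 4 * (1 + 2 * (16 * (1 + 342) / klE0))) ^ 8)) *
      (2 / ((2 * (L / 4 + 1) : ℕ) : ℝ)) ^ (8 - 0 - 4) * (2 ^ 2 * ∑' k : Fin 2 → ℤ, ∏ i, (1 + (k i : ℝ) ^ 2)⁻¹)) := by
      rw [hXdef, div_mul_cancel₀ _ (pow_ne_zero 2 hU.ne')]
    rw [hX1]
    refine halias.trans ?_
    have hU8 : U ^ 8 ≤ (1 / (10 : ℝ) ^ 37) ^ 8 := pow_le_pow_left₀ hU.le hU37 8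
    have hU80 : 0 ≤ U ^ 8 := by positivity
    have h10 : U ^ 10 = U ^ 2 * U ^ 8 := by ring
    rw [h10]
    nlinarith [sq_nonneg U, mul_le_mul_of_nonneg_left hU8 (sq_nonneg U)]
  rw [abs_of_pos hU]
  have hUU : U ^ 2 ≤ U * (1 / (10 : ℝ) ^ 37) := by nlinarith
  have hTV : 2 * (S / (10 : ℝ) ^ 74) * U ≤ 2 * ((10 : ℝ) ^ 48 / (10 : ℝ) ^ 74) * U := by
    have : S / (10 : ℝ) ^ 74 ≤ (10 : ℝ) ^ 48 / (10 : ℝ) ^ 74 := div_le_div_of_nonneg_right hS (by positivity)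
    nlinarith
  have hTB : (2 / (1 : ℝ)) ^ 0 * S / (10 : ℝ) ^ 37 ≤ (10 : ℝ) ^ 11 := by
    rw [pow_zero, one_mul, div_le_iff₀ (by positivity)]
    calc S ≤ (10 : ℝ) ^ 48 := hS
      _ = (10 : ℝ) ^ 11 * (10 : ℝ) ^ 37 := by norm_num
  have hBSA : 16 * 16 * klScaleZeroA0 ≤ (10 : ℝ) ^ 16 := by
    calc 16 * 16 * klScaleZeroA0 ≤ 16 * 16 * (2 : ℝ) ^ 43 := by gcongr
      _ ≤ _ := by norm_num
  have hcoef : 2 * ((2 / (1 : ℝ)) ^ 0 * S / (10 : ℝ) ^ 37) + 16 * 16 * klScaleZeroA0 + X + 2048 + 64 * ε ≤ 4 * (10 : ℝ) ^ 16 + X := by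
    linarith
  have hexp : 3 * (2 * (S / (10 : ℝ) ^ 74) * U + (2 * ((2 / (1 : ℝ)) ^ 0 * S / (10 : ℝ) ^ 37) + 16 * 16 * klScaleZeroA0 + X + 2048 + 64 * ε) * U ^ 2) ≤
      3 * (2 * ((10 : ℝ) ^ 48 / (10 : ℝ) ^ 74) * U + (4 * (10 : ℝ) ^ 16) * U ^ 2 + U ^ 2) := by
    have hU2 : 0 ≤ U ^ 2 := sq_nonneg U
    nlinarith [mul_le_mul_of_nonneg_right hcoef hU2]
  have hTU : U * (1 / 128) ≤ U * T := mul_le_mul_of_nonneg_left hT0 hU.le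
  have hfin : 3 * (2 * ((10 : ℝ) ^ 48 / (10 : ℝ) ^ 74) * U + (4 * (10 : ℝ) ^ 16) * U ^ 2 + U ^ 2) < U * (1 / 128) := by
    nlinarith
  linarith

/-- **THE GUARDED Gfr-ROW OF `hres′` ON THE ENGINE REGIME, NO TADPOLE HYPOTHESIS** (∘ ✓ p715417): for `R.WF2`, the dummy-frame history, `μ ∈ klWindowC`,
`0 < U ≤ klEngU₀9 P R c`, `klBetaMin ≤ β`, `klEngL₃ β U ≤ L`, `klEngM₃ β U L ≤ M`: `1 ≤ n → 0 < R.Gfr 0`. [cite: BenfattoGiulianiMastropietro2006, §3 (3.2)-(3.3)] -/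
theorem hresGuard_gfr_row_klEng {G : GeoConsts} (P : SplitConsts) {Q : EngConsts} {R : RenConsts} (c : ℝ) {n : ℕ} (hR : R.WF2)
    (hhist : HistP klPredsV17F2 L M G P Q R β U μ 0 n) (hμ : μ ∈ klWindowC) (hU : 0 < U) (hU9 : U ≤ klEngU₀9 P R c)
    (hβ : klBetaMin ≤ β) (hL : klEngL₃ β U ≤ L) (hM : klEngM₃ β U L ≤ M) : 1 ≤ n → 0 < R.Gfr 0 :=
  hresGuard_gfr_row_of_tadpole hR hhist (exists_evalM_klFlowPiece_zero_ne_zero_klEng (L := L) (M := M) P c hR hμ hU hU9 hβ hL hM)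

end Discharge

end Summit.HubbardSuperconductivity.HubbardSuperconductivity.Theorems.KLRegimeSplit

end
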